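import Summits.NavierStokesRegularity.NavierStokesRegularity.Theorems.CertifiedBlowupCertifiedBlowupAxisymBlowupL3Blowup
import Literature.Analysis.FluidPDE.FujitaKatoGlobal
import Literature.Analysis.FunctionSpaces.FourierSobolevNormEmbeddingProofs
import HarnessLib

/-!
# Witnesses of the crux `CertifiedBlowupAxisymBlowup`: the Fujita–Kato norm `‖u(t)‖_{Ḣ^{1/2}}`
# blows up at the lifespan

Theorems file landed `--supports stmt-NavierStokesRegularity-0727`, line `compact-amplification`
(continuation lead c4, wave 2; registered stub
`tendsto_eHomSobolevSeminorm_half_of_isMaximalSmoothSolution`). A witness of the crux is a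
viscosity `ν > 0`, a time `T > 0` and a maximal smooth solution `(u, p)` of the unforced
Navier–Stokes system of finite lifespan `T`, Leray–Hopf on `[0, T]` from its rapidly decaying
axisymmetric datum `u 0`. This file proves, for an ARBITRARY such witness and using only PROVED
theorems of the tree, that the critical Fujita–Kato norm blows up at the singular time:
`‖u(t)‖_{Ḣ^{1/2}(ℝ³)} → ∞` as `t ↑ T` (the seminorm being the Fourier-side
`Function.eHomSobolevSeminorm (1/2)` of the complexified slice `complexify ∘ u t`, junk value `∞`
off `L²`). It is the companion of the landed Seregin `L³` blow-up
(`tendsto_eLpNorm_three_nhdsLT_of_isMaximalSmoothSolution`, Seregin 2012, Thm. 1.1) and of the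
Rusin–Šverák threshold theorem (`rusinSverakRhoMax_le_of_isMaximalSmoothSolution`).

Proof: every slice `u t`, `0 ≤ t < T`, is an `L²` field (`IsLerayHopfOn.memLp`), so is its
complexification (`memLp_complexify_comp`, `complexify` being an isometry `ℝ³ →ₗᵢ[ℝ] ℂ³`, whence
also `‖complexify ∘ u t‖_{L³} = ‖u t‖_{L³}`); the critical Sobolev embedding `Ḣ^{1/2}(ℝ³) ↪ L³(ℝ³)`
(Bahouri–Chemin–Danchin 2011, Thm. 1.38, the tree's discharged
`eLpNorm_three_le_eHomSobolevSeminorm_half_holds`) gives `‖u(t)‖_{L³} ≤ C ‖u(t)‖_{Ḣ^{1/2}}`, and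
`‖u(t)‖_{L³} → ∞` (Seregin) forces `‖u(t)‖_{Ḣ^{1/2}} → ∞`.

No new definitions, no named-fact hypotheses, no `sorry`.

## References

* H. Fujita, T. Kato, *On the Navier–Stokes initial value problem. I*, Arch. Rational Mech.
  Anal. 16 (1964) 269–315, Thm. 1.2 (the critical space `Ḣ^{1/2}`). [FujitaKato1964ARMA]
* H. Bahouri, J.-Y. Chemin, R. Danchin, *Fourier Analysis and Nonlinear Partial Differential
  Equations*, Grundlehren 343, Springer (2011), Def. 1.31, Thm. 1.38. [BahouriCheminDanchin2011]
* G. Seregin, *A certain necessary condition of potential blow up for Navier–Stokes equations*,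
  Comm. Math. Phys. 312 (2012), 833–845, Thm. 1.1. [Seregin2012] [Seregin2012CMP]
-/

-- the summit and its single problem share the name (D-0017 nested layout)
set_option linter.dupNamespace false

noncomputable section

open MeasureTheory Set Function Filter Topology Metric
open scoped ENNReal NNReal

namespace Summit.NavierStokesRegularity.NavierStokesRegularity.Theorems.CertifiedBlowupAxisymBlowup.CompactAmplification

open Literature.Analysis Literature.Analysis.FluidPDE

section Witness

variable {ν T : ℝ} {u : ℝ → (EuclideanSpace ℝ (Fin 3)) → (EuclideanSpace ℝ (Fin 3))} {p : ℝ → (EuclideanSpace ℝ (Fin 3)) → ℝ}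

/-- **The `L³` norm is unchanged by complexification**: `‖complexify ∘ f‖_{L³} = ‖f‖_{L³}`, since
`complexify : ℝ³ →ₗᵢ[ℝ] ℂ³` preserves the pointwise norm (`norm_complexify`). [folklore] -/
theorem eLpNorm_complexify_comp (f : EuclideanSpace ℝ (Fin 3) → EuclideanSpace ℝ (Fin 3))
    (q : ℝ≥0∞) :
    eLpNorm (FunctionSpaces.EuclideanSpace.complexify ∘ f) q volume = eLpNorm f q volume :=
  eLpNorm_congr_norm_ae (Eventually.of_forall fun x =>
    FunctionSpaces.EuclideanSpace.norm_complexify (f x))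

/-- **The critical embedding `Ḣ^{1/2}(ℝ³) ↪ L³(ℝ³)` along a Leray–Hopf solution**: there is a
constant `C` with `‖u(t)‖_{L³} ≤ C ‖u(t)‖_{Ḣ^{1/2}}` for every `t ∈ [0, T]`, the right-hand
seminorm being that of the complexified slice (every slice is an `L²` field, `IsLerayHopfOn.memLp`,
so the embedding `eLpNorm_three_le_eHomSobolevSeminorm_half_holds` applies to `complexify ∘ u t`,
whose `L³` norm is that of `u t`). [cite: BahouriCheminDanchin2011, Thm. 1.38] -/
theorem exists_eLpNorm_three_le_eHomSobolevSeminorm_half_of_lerayHopf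
    (hLH : IsLerayHopfOn T ν 0 (u 0) u) :
    ∃ C : ℝ≥0, ∀ t ∈ Icc 0 T, eLpNorm (u t) 3 volume ≤
      C * Function.eHomSobolevSeminorm (1 / 2 : ℝ) (FunctionSpaces.EuclideanSpace.complexify ∘ u t) := by
  obtain ⟨C, hC⟩ :=
    FunctionSpaces.eLpNorm_three_le_eHomSobolevSeminorm_half_holds (F := EuclideanSpace ℂ (Fin 3))
  refine ⟨C, fun t ht => ?_⟩
  rw [← eLpNorm_complexify_comp (u t) 3]
  exact hC _ (memLp_complexify_comp (hLH.memLp t ht))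

/-- **Blow-up of the Fujita–Kato norm at the lifespan** (curried form): along a maximal Leray–Hopf
classical solution of finite lifespan `T > 0` from a rapidly decaying axisymmetric datum,
`‖u(t)‖_{Ḣ^{1/2}} → ∞` as `t ↑ T` — from Seregin's `‖u(t)‖_{L³} → ∞`
(`tendsto_eLpNorm_three_nhdsLT_of_isMaximalSmoothSolution`) and the critical embedding
`‖u(t)‖_{L³} ≤ C ‖u(t)‖_{Ḣ^{1/2}}` on `[0, T)`. [cite: Seregin2012, Comm. Math. Phys. 312 Thm. 1.1] -/
theorem tendsto_eHomSobolevSeminorm_half_nhdsLT_of_isMaximalSmoothSolution (hν : 0 < ν) (hT : 0 < T)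
    (hmax : IsMaximalSmoothSolution ν 0 u p T) (hLH : IsLerayHopfOn T ν 0 (u 0) u)
    (hdec : HasRapidSpatialDecay (u 0)) (haxi : IsAxisymmetric (u 0)) :
    Tendsto (fun t => Function.eHomSobolevSeminorm (1 / 2 : ℝ)
      (FunctionSpaces.EuclideanSpace.complexify ∘ u t)) (𝓝[<] T) (𝓝 ∞) := by
  have h3 := tendsto_eLpNorm_three_nhdsLT_of_isMaximalSmoothSolution hν hT hmax hLH hdec haxi
  obtain ⟨C, hC⟩ := exists_eLpNorm_three_le_eHomSobolevSeminorm_half_of_lerayHopf hLH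
  have hIco : ∀ᶠ t in 𝓝[<] T, t ∈ Icc 0 T :=
    mem_of_superset (Ico_mem_nhdsLT hT) fun t ht => ⟨ht.1, ht.2.le⟩
  rw [ENNReal.tendsto_nhds_top_iff_nnreal] at h3 ⊢
  intro n
  rcases eq_or_ne C 0 with hC0 | hC0
  · -- degenerate constant: `‖u(t)‖_{L³} ≤ 0` contradicts `‖u(t)‖_{L³} > 0` near `T`
    filter_upwards [h3 0, hIco] with t ht htI
    exact absurd ((hC t htI).trans_eq (by rw [hC0, ENNReal.coe_zero, zero_mul])) (not_le.2 ht)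
  · filter_upwards [h3 (C * n), hIco] with t ht htI
    have h := ht.trans_le (hC t htI)
    rw [ENNReal.coe_mul] at h
    exact (ENNReal.mul_lt_mul_iff_right (ENNReal.coe_ne_zero.2 hC0) ENNReal.coe_ne_top).1 h

end Witness

/-- **Blow-up of the Fujita–Kato critical norm at the crux** (registered stub of
stmt-NavierStokesRegularity-0727): for every witness `(ν, T, u, p)` of `CertifiedBlowupAxisymBlowup`
— a maximal Leray–Hopf classical solution of finite lifespan `T > 0`, viscosity `ν > 0`, from a
rapidly decaying axisymmetric datum — the homogeneous Sobolev seminorm `‖u(t)‖_{Ḣ^{1/2}(ℝ³)}` of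
the (complexified) slice tends to `∞` as `t ↑ T`: Seregin's `L³` blow-up (Seregin 2012, Thm. 1.1)
transported through the critical embedding `Ḣ^{1/2} ↪ L³` (Bahouri–Chemin–Danchin 2011,
Thm. 1.38). [cite: Seregin2012, Comm. Math. Phys. 312 Thm. 1.1] -/
theorem tendsto_eHomSobolevSeminorm_half_of_isMaximalSmoothSolution : ∀ {ν T : ℝ} {u : ℝ → EuclideanSpace ℝ (Fin 3) → EuclideanSpace ℝ (Fin 3)} {p : ℝ → EuclideanSpace ℝ (Fin 3) → ℝ}, 0 < ν → 0 < T → IsMaximalSmoothSolution ν 0 u p T → IsLerayHopfOn T ν 0 (u 0) u → HasRapidSpatialDecay (u 0) → IsAxisymmetric (u 0) → Filter.Tendsto (fun t => Function.eHomSobolevSeminorm (1 / 2 : ℝ) (FunctionSpaces.EuclideanSpace.complexify ∘ u t)) (nhdsWithin T (Set.Iio T)) (nhds ⊤) :=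
  fun hν hT hmax hLH hdec haxi =>
    tendsto_eHomSobolevSeminorm_half_nhdsLT_of_isMaximalSmoothSolution hν hT hmax hLH hdec haxi

end Summit.NavierStokesRegularity.NavierStokesRegularity.Theorems.CertifiedBlowupAxisymBlowup.CompactAmplification

end
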